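/-
Copyright (c) 2026. All rights reserved.
Released under Apache 2.0 license as described in the file LICENSE.
-/
import Mathlib
import HarnessLib
import Summits.RiemannHypothesis.RiemannHypothesis.Theses.EarlyAppointments

/-!
# Lower bound on |G(z₀).im| for CombDescentStep

The key bound: when C·s ≤ h with C ≥ 8, we have |G(z₀).im| > 1/h.
-/

open Complex Real Set Filter Topology
open scoped BigOperators Topology ComplexConjugate

noncomputable section

namespace GImagBound

variable {x₀ s h : ℝ}

/-- The main point z₀ = x₀ + ih. -/
def z₀ (x₀ h : ℝ) : ℂ := (x₀ : ℂ) + h * I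

/-- The key lower bound: when C·s ≤ h with C ≥ 8, we have
π/s - 5/(2h) > 1/h.

For h/s ≥ 8, π/s ≥ 8π/h > 25/h, so π/s - 5/(2h) > 22.5/h > 1/h. -/
theorem imag_bound_main (hs : 0 < s) (hh : 0 < h) (hhs : 8 * s ≤ h) :
    π / s - 5 / (2 * h) > 1 / h := by
  have hπ : π > 3 := Real.pi_gt_three
  have pi_s_bound : π / s ≥ 8 * π / h := by
    rw [ge_iff_le, div_le_div_iff₀ hh hs]
    nlinarith
  -- 8π/h - 5/(2h) = (16π - 5)/(2h) > 1/h iff 16π - 5 > 2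
  have key1 : 8 * π - 5 / 2 > 1 := by nlinarith
  have key2 : (8 * π - 5 / 2) / h > 1 / h := by
    have h2 : (8 * π - 5 / 2) / h - 1 / h = (8 * π - 5 / 2 - 1) / h := by field_simp
    have h3 : 8 * π - 5 / 2 - 1 > 0 := by nlinarith
    have h4 : (8 * π - 5 / 2) / h - 1 / h > 0 := by rw [h2]; positivity
    linarith
  have key3 : 8 * π / h - 5 / (2 * h) = (8 * π - 5 / 2) / h := by field_simp
  linarith

end GImagBound

end
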